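import Mathlib
import Summits.CriticalPhenomena.CardyFormulaZ2.Theorems.CardyMagicRigidityNestingRigidityUVFarBiteScales
import Summits.CriticalPhenomena.CardyFormulaZ2.Theorems.CardyMagicRigidityNestingRigidityBigLoopsExpMomentMeetBall
import HarnessLib

/-!
# Crux `MagicFormulaT`, line `Sketch` (v6): stub S2 — band first moments

Crux `Summit.CriticalPhenomena.CardyFormulaZ2.Theses.CardyMagicRigidity.MagicFormulaT`
(stmt-CriticalPhenomena-4836), line `Sketch`, registered stub `stub_bandFirstMoment` (S2, "band first
moments").  For `E ∈ latticeEnsembles` there is ONE constant `K₁ > 0` such that for every window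
`B(x₀, ρ)`, region `D ⊆ B(x₀, ρ)`, mesh and cut-off `0 < δ ≤ η ≤ ρ`, and every loop functional `g`
with `|g u| ≤ κ diam(u)⁴` on the loops inside `D` VANISHING on the loops of diameter `≥ η`, the inner
statistic `S = Σ_{u ∈ X_δ, trace u ⊆ D} g u` is integrable with `E|S| ≤ K₁ κ ρ² η²`.

Proof (no cited fact, no definition; the cell data are the file-local notations of
…NestingRigidityUVFarBiteCells, re-declared verbatim).  Only the loops of diameter `< η` contribute;
split them into the dyadic scales `h_k = η 2^{-k}`, `k < n` (`η 2^{-n} ≤ 4δ`) and the microscopic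
loops (`diam < η 2^{-n}`), and each scale into cells (`UVFarBite.finsum_mem_eq_micro_add_sum_scales`,
`UVFarBite.finsum_mem_eq_sum_cells`).  A cell of scale `k` carries `|Σ g| ≤ κ h_k⁴ N_{k,c}` with
`N_{k,c}` the number of loops of diameter `≥ h_k/2` inside the window `B(centre, 3h_k)`, and
`E N_{k,c} ≤ E e^{N_{k,c}} ≤ K` by the keystone `expMoment_ncard_bigLoops_le_ball_free` (all centres,
all scales, no mesh constraint); with `#cells ≤ (2ρ/h_k + 2)²` the scales give
`≤ 16 κ K ρ² Σ_k h_k² ≤ 32 κ K ρ² η²`.  A microscopic cell carries at most `M` loops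
(`exists_ncard_loops_subset_ball_le`, windows of radius `12δ`), each with `|g| ≤ κ (η 2^{-n})⁴`, whence
`≤ 16 κ M ρ² η²`.  So `K₁ = 16 M + 32 K`.
-/

noncomputable section

open MeasureTheory Filter Set Metric
open scoped Real Topology BigOperators

namespace Summit.CriticalPhenomena.CardyFormulaZ2.Cruxes.MagicFormulaT.LineSketch

open Literature.Probability.RandomPlanarGeometry Literature.Probability.Percolation
  Literature.Probability.LatticeModels
open Summit.CriticalPhenomena.CardyFormulaZ2.Cruxes.NestingRigidity.RingCloudTomography
open Summit.CriticalPhenomena.CardyFormulaZ2.Cruxes.NestingRigidity.PositiveConeWeightDoubling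

/-- Abscissa of the left edge of the bounding box of a loop (local notation, as in …UVFarBiteCells). -/
local notation3 "XI[" u "]" => sInf (Complex.re '' UnbasedLoop.range u)
/-- Ordinate of the bottom edge of the bounding box of a loop (local notation). -/
local notation3 "YI[" u "]" => sInf (Complex.im '' UnbasedLoop.range u)
/-- The grid cell (side `h`) containing the lower-left corner of the bounding box (local notation). -/
local notation3 "IDX[" h ", " u "]" => ((⌊XI[u] / h⌋, ⌊YI[u] / h⌋) : ℤ × ℤ)
/-- The doubled cell `[ih, (i+2)h] × [jh, (j+2)h]` of the grid cell `c = (i, j)` (local notation). -/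
local notation3 "BOX[" h ", " c "]" => {z : ℂ | ((Prod.fst c : ℤ) : ℝ) * h ≤ z.re ∧
  z.re ≤ (((Prod.fst c : ℤ) : ℝ) + 2) * h ∧ ((Prod.snd c : ℤ) : ℝ) * h ≤ z.im ∧
  z.im ≤ (((Prod.snd c : ℤ) : ℝ) + 2) * h}
/-- The centre `((i+1)h, (j+1)h)` of the doubled cell (local notation). -/
local notation3 "CTR[" h ", " c "]" =>
  (Complex.mk ((((Prod.fst c : ℤ) : ℝ) + 1) * h) ((((Prod.snd c : ℤ) : ℝ) + 1) * h) : ℂ)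
/-- The cells that loops inside `B(x₀, ρ)` can be assigned to (local notation). -/
local notation3 "RNG[" h ", " x₀ ", " ρ "]" => (Finset.Icc ⌊(Complex.re x₀ - ρ) / h⌋ ⌊(Complex.re x₀ + ρ) / h⌋ ×ˢ
  Finset.Icc ⌊(Complex.im x₀ - ρ) / h⌋ ⌊(Complex.im x₀ + ρ) / h⌋ : Finset (ℤ × ℤ))

/-! ## Helpers (`bfm_`) -/

/-- **The loops of a cell in inner-loop form** (band version of `UVFarBite.sep_sep_idx_eq`): for a
predicate forcing `diam < h ≤ η`, the loops inside `D` of diameter `< η` with `Q'` indexed by the cell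
`c` are the loops inside `D ∩ (doubled cell c)` with `Q'` indexed by `c`. -/
theorem bfm_cell_eq (L : Set (UnbasedLoop ℂ)) (D : Set ℂ) {h η : ℝ} (hh : 0 < h) (hhη : h ≤ η)
    (Q' : UnbasedLoop ℂ → Prop) (hQ' : ∀ u, Q' u → diam u.range < h) (c : ℤ × ℤ) :
    {u ∈ {u ∈ {u ∈ L | u.range ⊆ D ∧ diam u.range < η} | Q' u} | IDX[h, u] = c} =
      {u ∈ L | u.range ⊆ D ∩ BOX[h, c] ∧ (Q' u ∧ IDX[h, u] = c)} := by
  ext u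
  simp only [mem_setOf_eq, subset_inter_iff]
  constructor
  · rintro ⟨⟨⟨hu, hD, -⟩, hQ⟩, hc⟩
    refine ⟨hu, ⟨hD, ?_⟩, hQ, hc⟩
    rw [← hc]
    exact UVFarBite.range_subset_cellBox hh (hQ' u hQ).le
  · rintro ⟨hu, ⟨hD, -⟩, hQ, hc⟩
    exact ⟨⟨⟨hu, hD, (hQ' u hQ).trans_le hhη⟩, hQ⟩, hc⟩

/-- **One cell term**: `#cells · κ h⁴ T ≤ 16 κ T ρ² h²` when `#cells ≤ (2ρ/h + 2)²` and `h ≤ ρ`. -/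
theorem bfm_cell_term_le {h ρ κ T S : ℝ} (hh : 0 < h) (hhρ : h ≤ ρ) (hκ : 0 ≤ κ) (hT : 0 ≤ T)
    (hS : S ≤ (2 * ρ / h + 2) ^ 2) : S * (κ * h ^ 4 * T) ≤ 16 * κ * T * ρ ^ 2 * h ^ 2 := by
  have hρ : 0 < ρ := hh.trans_le hhρ
  have hh' : h ≠ 0 := hh.ne'
  calc S * (κ * h ^ 4 * T) ≤ (2 * ρ / h + 2) ^ 2 * (κ * h ^ 4 * T) :=
        mul_le_mul_of_nonneg_right hS (by positivity)
    _ = κ * T * (2 * ρ + 2 * h) ^ 2 * h ^ 2 := by field_simp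
    _ ≤ κ * T * (4 * ρ) ^ 2 * h ^ 2 := by gcongr; linarith
    _ = 16 * κ * T * ρ ^ 2 * h ^ 2 := by ring

/-- The squared dyadic sides: `(η/2^k)² = η² (1/4)^k`. -/
theorem bfm_side_sq (η : ℝ) (k : ℕ) : (η / 2 ^ k) ^ 2 = η ^ 2 * (1 / 4) ^ k := by
  rw [div_pow, ← pow_mul, mul_comm k 2, pow_mul, one_div_pow, div_eq_mul_one_div]
  norm_num

/-! ## The stub -/

/-- **Stub S2 (`BandFirstMoment`; both lattices).**  For `E ∈ latticeEnsembles` there is `K₁ > 0`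
such that every inner statistic `Σ_{u ⊆ D} g u` (`D ⊆ B(x₀, ρ)`, mesh `0 < δ ≤ η ≤ ρ`) with
`|g u| ≤ κ · diam⁴` vanishing on the loops of diameter `≥ η` is integrable with `E|Σ| ≤ K₁ κ ρ² η²`:
dyadic scales `h_k = η 2^{-k}` and cells, `|g| ≤ κ h_k⁴` on `≤ N_{k,c}` loops per cell with
`E N ≤ E e^N ≤ K` (`expMoment_ncard_bigLoops_le_ball_free` at order `1`),
`Σ_k (2ρ/h_k + 2)² κ h_k⁴ K ≤ 32 κ K ρ² η²`; microscopic cells of side `η 2^{-n} ≤ 4δ` with `≤ M`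
loops each (`exists_ncard_loops_subset_ball_le`), `≤ 16 κ M ρ² η²`. -/
theorem stub_bandFirstMoment : ∀ E ∈ latticeEnsembles, ∃ K₁ : ℝ, 0 < K₁ ∧
    ∀ (x₀ : ℂ) (ρ κ δ η : ℝ) (D : Set ℂ) (g : UnbasedLoop ℂ → ℝ),
      0 < δ → δ ≤ η → η ≤ ρ → 0 ≤ κ → D ⊆ Metric.ball x₀ ρ →
      (∀ u : UnbasedLoop ℂ, u.range ⊆ D → |g u| ≤ κ * Metric.diam u.range ^ 4) →
      (∀ u : UnbasedLoop ℂ, u.range ⊆ D → η ≤ Metric.diam u.range → g u = 0) →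
      Integrable (fun ω ↦ ∑ᶠ u ∈ {u ∈ (E.X δ ω).loops | u.range ⊆ D}, g u) E.P ∧
      ∫ ω, |∑ᶠ u ∈ {u ∈ (E.X δ ω).loops | u.range ⊆ D}, g u| ∂E.P ≤ K₁ * κ * ρ ^ 2 * η ^ 2 := by
  intro E hE
  haveI := isProbabilityMeasure_of_mem hE
  obtain ⟨K, hK, hK6⟩ := expMoment_ncard_bigLoops_le_ball_free E hE 1 6 1 one_pos (by norm_num)
  obtain ⟨M, hM⟩ := exists_ncard_loops_subset_ball_le E hE 12
  refine ⟨16 * M + 32 * K, by positivity, ?_⟩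
  intro x₀ ρ κ δ η D g hδ hδη hηρ hκ hD hg hgη
  have hη : 0 < η := hδ.trans_le hδη
  have hρ : 0 < ρ := hη.trans_le hηρ
  -- integrability of the inner statistic (`|g| ≤ κ (2ρ)⁴` on the loops inside `D`)
  have hint : Integrable (fun ω ↦ ∑ᶠ u ∈ {u ∈ (E.X δ ω).loops | u.range ⊆ D}, g u) E.P := by
    have h := UVFarBite.integrable_finsum_inner E hE hδ D x₀ ρ (fun _ ↦ True) g
      (b := κ * (2 * ρ) ^ 4) (by positivity) hD fun u hu _ ↦ (hg u hu).trans
        (mul_le_mul_of_nonneg_left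
          (pow_le_pow_left₀ diam_nonneg (UVFarBite.diam_le_two_mul hρ.le (hu.trans hD)) 4) hκ)
    simpa only [and_true] using h
  refine ⟨hint, ?_⟩
  -- the number `n` of dyadic scales: `η / 2^n ≤ 4δ`
  obtain ⟨n, hn4⟩ : ∃ n : ℕ, η / 2 ^ n ≤ 4 * δ := by
    obtain ⟨n, hn⟩ := exists_pow_lt_of_lt_one (show 0 < 4 * δ / η by positivity)
      (show (1 / 2 : ℝ) < 1 by norm_num)
    refine ⟨n, ?_⟩
    calc η / 2 ^ n = η * (1 / 2) ^ n := by rw [one_div_pow, div_eq_mul_one_div]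
      _ ≤ η * (4 * δ / η) := mul_le_mul_of_nonneg_left hn.le hη.le
      _ = 4 * δ := mul_div_cancel₀ _ hη.ne'
  have hk0 : ∀ k : ℕ, 0 < η / 2 ^ k := fun k ↦ by positivity
  have hkη : ∀ k : ℕ, η / 2 ^ k ≤ η := fun k ↦ div_le_self hη.le (one_le_pow₀ (by norm_num))
  -- windows of the cells
  have hwin : ∀ (k : ℕ) (c : ℤ × ℤ), D ∩ BOX[η / 2 ^ k, c] ⊆
      ball CTR[η / 2 ^ k, c] (η / 2 ^ k / 2 * 6) := fun k c ↦
    Set.inter_subset_right.trans (by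
      rw [show η / 2 ^ k / 2 * 6 = 3 * (η / 2 ^ k) by ring]
      exact UVFarBite.cellBox_subset_ball (hk0 k) c)
  have hwinμ : ∀ c : ℤ × ℤ, D ∩ BOX[η / 2 ^ n, c] ⊆ ball CTR[η / 2 ^ n, c] (12 * δ) := fun c ↦
    Set.inter_subset_right.trans ((UVFarBite.cellBox_subset_ball (hk0 n) c).trans
      (ball_subset_ball (by linarith)))
  -- the cell statistics and the window counts, kept opaque
  obtain ⟨Yμ, hYμ⟩ : ∃ Yμ : ℤ × ℤ → E.Ω → ℝ, ∀ c ω, Yμ c ω = ∑ᶠ u ∈ {u ∈ (E.X δ ω).loops |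
      u.range ⊆ D ∩ BOX[η / 2 ^ n, c] ∧ (diam u.range < η / 2 ^ n ∧ IDX[η / 2 ^ n, u] = c)}, g u :=
    ⟨_, fun _ _ ↦ rfl⟩
  obtain ⟨Ys, hYs⟩ : ∃ Ys : ℕ → ℤ × ℤ → E.Ω → ℝ, ∀ k c ω, Ys k c ω = ∑ᶠ u ∈ {u ∈ (E.X δ ω).loops |
      u.range ⊆ D ∩ BOX[η / 2 ^ k, c] ∧
        ((η / 2 ^ k / 2 ≤ diam u.range ∧ diam u.range < η / 2 ^ k) ∧ IDX[η / 2 ^ k, u] = c)}, g u :=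
    ⟨_, fun _ _ _ ↦ rfl⟩
  obtain ⟨N, hN⟩ : ∃ N : ℕ → ℤ × ℤ → E.Ω → ℝ, ∀ k c ω, N k c ω = ({u ∈ (E.X δ ω).loops |
      u.range ⊆ Metric.ball CTR[η / 2 ^ k, c] (η / 2 ^ k / 2 * 6) ∧
        η / 2 ^ k / 2 * 1 ≤ Metric.diam u.range}.ncard : ℝ) :=
    ⟨_, fun _ _ _ ↦ rfl⟩
  -- only the loops of diameter `< η` contribute
  have hrestr : ∀ ω, (∑ᶠ u ∈ {u ∈ (E.X δ ω).loops | u.range ⊆ D}, g u) =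
      ∑ᶠ u ∈ {u ∈ (E.X δ ω).loops | u.range ⊆ D ∧ diam u.range < η}, g u := fun ω ↦
    finsum_mem_inter_support_eq' g _ _ fun u hu ↦
      ⟨fun h ↦ ⟨h.1, h.2, not_le.1 fun hle ↦ hu (hgη u h.2 hle)⟩, fun h ↦ ⟨h.1, h.2.1⟩⟩
  -- pointwise decomposition of `S`
  have hdec : ∀ ω, (∑ᶠ u ∈ {u ∈ (E.X δ ω).loops | u.range ⊆ D}, g u) =
      ∑ c ∈ RNG[η / 2 ^ n, x₀, ρ], Yμ c ω +
        ∑ k ∈ Finset.range n, ∑ c ∈ RNG[η / 2 ^ k, x₀, ρ], Ys k c ω := by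
    intro ω
    obtain ⟨N₀, hN₀⟩ := BigLoopsBall.exists_ncard_loops_sep_le_ball E hE hδ x₀ ρ
    have hB : {u ∈ (E.X δ ω).loops | u.range ⊆ D ∧ diam u.range < η}.Finite :=
      (hN₀ (fun u ↦ u.range ⊆ D ∧ diam u.range < η) (fun u h ↦ h.1.trans hD) ω).1
    have hBball : ∀ u ∈ {u ∈ (E.X δ ω).loops | u.range ⊆ D ∧ diam u.range < η},
        u.range ⊆ ball x₀ ρ := fun u hu ↦ hu.2.1.trans hD
    rw [hrestr ω, UVFarBite.finsum_mem_eq_micro_add_sum_scales hB hη n (fun u hu ↦ hu.2.2) g]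
    congr 1
    · rw [UVFarBite.finsum_mem_eq_sum_cells (hB.subset fun u hu ↦ hu.1) (hk0 n)
        (fun u hu ↦ hBball u hu.1) g]
      refine Finset.sum_congr rfl fun c _ ↦ ?_
      rw [bfm_cell_eq _ D (hk0 n) (hkη n) _ (fun u hu ↦ hu) c, hYμ]
    · refine Finset.sum_congr rfl fun k _ ↦ ?_
      rw [UVFarBite.finsum_mem_eq_sum_cells (hB.subset fun u hu ↦ hu.1) (hk0 k)
        (fun u hu ↦ hBball u hu.1) g]
      refine Finset.sum_congr rfl fun c _ ↦ ?_
      rw [bfm_cell_eq _ D (hk0 k) (hkη k) _ (fun u hu ↦ hu.2) c, hYs]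
  -- the cell bounds
  have hYsle : ∀ k c ω, |Ys k c ω| ≤ κ * (η / 2 ^ k) ^ 4 * N k c ω := by
    intro k c ω
    rw [hYs, hN]
    exact UVFarBite.abs_finsum_inner_le_mul_ncard E hE hδ ω (D ∩ BOX[η / 2 ^ k, c])
      CTR[η / 2 ^ k, c] (η / 2 ^ k / 2 * 6)
      (fun u ↦ (η / 2 ^ k / 2 ≤ diam u.range ∧ diam u.range < η / 2 ^ k) ∧ IDX[η / 2 ^ k, u] = c)
      (fun u ↦ η / 2 ^ k / 2 * 1 ≤ Metric.diam u.range) g (b := κ * (η / 2 ^ k) ^ 4)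
      (by positivity) (hwin k c) fun u hu hq ↦
        ⟨(hg u (hu.trans Set.inter_subset_left)).trans
          (mul_le_mul_of_nonneg_left (pow_le_pow_left₀ diam_nonneg hq.1.2.le 4) hκ),
         by rw [mul_one]; exact hq.1.1⟩
  have hYμle : ∀ c ω, |Yμ c ω| ≤ κ * (η / 2 ^ n) ^ 4 * M := by
    intro c ω
    rw [hYμ]
    have h1 := UVFarBite.abs_finsum_inner_le_mul_ncard E hE hδ ω (D ∩ BOX[η / 2 ^ n, c])
      CTR[η / 2 ^ n, c] (12 * δ) (fun u ↦ diam u.range < η / 2 ^ n ∧ IDX[η / 2 ^ n, u] = c)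
      (fun _ ↦ True) g (b := κ * (η / 2 ^ n) ^ 4) (by positivity) (hwinμ c) fun u hu hq ↦
        ⟨(hg u (hu.trans Set.inter_subset_left)).trans
          (mul_le_mul_of_nonneg_left (pow_le_pow_left₀ diam_nonneg hq.1.le 4) hκ), trivial⟩
    refine h1.trans (mul_le_mul_of_nonneg_left ?_ (by positivity))
    obtain ⟨hfin, hcard⟩ := hM δ hδ CTR[η / 2 ^ n, c] ω
    have hsub : {u ∈ (E.X δ ω).loops | u.range ⊆ ball CTR[η / 2 ^ n, c] (12 * δ) ∧ True} ⊆
        {u ∈ (E.X δ ω).loops | u.range ⊆ ball CTR[η / 2 ^ n, c] (12 * δ)} :=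
      fun u hu ↦ ⟨hu.1, hu.2.1⟩
    exact_mod_cast (Set.ncard_le_ncard hsub hfin).trans hcard
  -- the pathwise bound
  have hpath : ∀ ω, |∑ᶠ u ∈ {u ∈ (E.X δ ω).loops | u.range ⊆ D}, g u| ≤
      ((RNG[η / 2 ^ n, x₀, ρ]).card : ℝ) * (κ * (η / 2 ^ n) ^ 4 * M) +
        ∑ k ∈ Finset.range n, ∑ c ∈ RNG[η / 2 ^ k, x₀, ρ], κ * (η / 2 ^ k) ^ 4 * N k c ω := by
    intro ω
    rw [hdec ω]
    refine (abs_add_le _ _).trans (add_le_add ?_ ?_)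
    · refine (Finset.abs_sum_le_sum_abs _ _).trans ?_
      refine (Finset.sum_le_sum fun c _ ↦ hYμle c ω).trans ?_
      rw [Finset.sum_const, nsmul_eq_mul]
    · refine (Finset.abs_sum_le_sum_abs _ _).trans (Finset.sum_le_sum fun k _ ↦ ?_)
      exact (Finset.abs_sum_le_sum_abs _ _).trans (Finset.sum_le_sum fun c _ ↦ hYsle k c ω)
  -- integrability and means of the window counts
  have hNint : ∀ k c, Integrable (N k c) E.P := fun k c ↦ by
    rw [show N k c = fun ω ↦ N k c ω from rfl]
    simp_rw [hN]
    exact BigLoops.integrable_ncard_loops_sep E hE hδ _ _ fun u hu ↦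
      hu.1.trans (BigLoopsBall.ball_subset_ball_zero _ _)
  have hNle : ∀ k c, ∫ ω, N k c ω ∂E.P ≤ K := fun k c ↦ by
    obtain ⟨hKi, hKle⟩ := hK6 CTR[η / 2 ^ k, c] (η / 2 ^ k / 2) δ (by positivity) hδ
    refine le_trans (integral_mono (hNint k c) hKi fun ω ↦ ?_) hKle
    change N k c ω ≤ _
    rw [hN, one_mul]
    exact (le_add_of_nonneg_right zero_le_one).trans (Real.add_one_le_exp _)
  have hFint : Integrable (fun ω ↦ ((RNG[η / 2 ^ n, x₀, ρ]).card : ℝ) * (κ * (η / 2 ^ n) ^ 4 * M) +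
      ∑ k ∈ Finset.range n, ∑ c ∈ RNG[η / 2 ^ k, x₀, ρ], κ * (η / 2 ^ k) ^ 4 * N k c ω) E.P :=
    (integrable_const _).add (integrable_finsetSum _ fun k _ ↦
      integrable_finsetSum _ fun c _ ↦ (hNint k c).const_mul _)
  -- the arithmetic of the two pieces
  have hmicro : ((RNG[η / 2 ^ n, x₀, ρ]).card : ℝ) * (κ * (η / 2 ^ n) ^ 4 * M) ≤
      16 * κ * M * ρ ^ 2 * η ^ 2 :=
    (bfm_cell_term_le (hk0 n) ((hkη n).trans hηρ) hκ (Nat.cast_nonneg M)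
      (UVFarBite.card_cellRange_le (hk0 n) x₀ hρ.le)).trans
      (mul_le_mul_of_nonneg_left (pow_le_pow_left₀ (hk0 n).le (hkη n) 2) (by positivity))
  have hscales : ∑ k ∈ Finset.range n, ∑ _c ∈ RNG[η / 2 ^ k, x₀, ρ], κ * (η / 2 ^ k) ^ 4 * K ≤
      32 * κ * K * ρ ^ 2 * η ^ 2 := by
    calc ∑ k ∈ Finset.range n, ∑ _c ∈ RNG[η / 2 ^ k, x₀, ρ], κ * (η / 2 ^ k) ^ 4 * K
        = ∑ k ∈ Finset.range n, ((RNG[η / 2 ^ k, x₀, ρ]).card : ℝ) * (κ * (η / 2 ^ k) ^ 4 * K) := by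
          simp_rw [Finset.sum_const, nsmul_eq_mul]
      _ ≤ ∑ k ∈ Finset.range n, 16 * κ * K * ρ ^ 2 * η ^ 2 * (1 / 4) ^ k :=
          Finset.sum_le_sum fun k _ ↦ (bfm_cell_term_le (hk0 k) ((hkη k).trans hηρ) hκ hK.le
            (UVFarBite.card_cellRange_le (hk0 k) x₀ hρ.le)).trans_eq (by rw [bfm_side_sq]; ring)
      _ = 16 * κ * K * ρ ^ 2 * η ^ 2 * ∑ k ∈ Finset.range n, (1 / 4 : ℝ) ^ k := by
          rw [Finset.mul_sum]
      _ ≤ 16 * κ * K * ρ ^ 2 * η ^ 2 * 2 :=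
          mul_le_mul_of_nonneg_left (BigLoopsExp.geom_sum_range_le_two (by norm_num) (by norm_num) n)
            (by positivity)
      _ = 32 * κ * K * ρ ^ 2 * η ^ 2 := by ring
  -- assembly
  calc ∫ ω, |∑ᶠ u ∈ {u ∈ (E.X δ ω).loops | u.range ⊆ D}, g u| ∂E.P
      ≤ ∫ ω, (((RNG[η / 2 ^ n, x₀, ρ]).card : ℝ) * (κ * (η / 2 ^ n) ^ 4 * M) +
          ∑ k ∈ Finset.range n, ∑ c ∈ RNG[η / 2 ^ k, x₀, ρ], κ * (η / 2 ^ k) ^ 4 * N k c ω) ∂E.P :=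
        integral_mono hint.abs hFint hpath
    _ = ((RNG[η / 2 ^ n, x₀, ρ]).card : ℝ) * (κ * (η / 2 ^ n) ^ 4 * M) +
          ∑ k ∈ Finset.range n, ∑ c ∈ RNG[η / 2 ^ k, x₀, ρ],
            κ * (η / 2 ^ k) ^ 4 * ∫ ω, N k c ω ∂E.P := by
        rw [integral_add (integrable_const _) (integrable_finsetSum _ fun k _ ↦
            integrable_finsetSum _ fun c _ ↦ (hNint k c).const_mul _),
          integral_const, probReal_univ, one_smul,
          integral_finsetSum _ fun k _ ↦ integrable_finsetSum _ fun c _ ↦ (hNint k c).const_mul _]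
        congr 1
        refine Finset.sum_congr rfl fun k _ ↦ ?_
        rw [integral_finsetSum _ fun c _ ↦ (hNint k c).const_mul _]
        exact Finset.sum_congr rfl fun c _ ↦ integral_const_mul _ _
    _ ≤ 16 * κ * M * ρ ^ 2 * η ^ 2 +
          ∑ k ∈ Finset.range n, ∑ _c ∈ RNG[η / 2 ^ k, x₀, ρ], κ * (η / 2 ^ k) ^ 4 * K :=
        add_le_add hmicro (Finset.sum_le_sum fun k _ ↦ Finset.sum_le_sum fun c _ ↦
          mul_le_mul_of_nonneg_left (hNle k c) (by positivity))
    _ ≤ 16 * κ * M * ρ ^ 2 * η ^ 2 + 32 * κ * K * ρ ^ 2 * η ^ 2 := add_le_add le_rfl hscales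
    _ = (16 * M + 32 * K) * κ * ρ ^ 2 * η ^ 2 := by ring

end Summit.CriticalPhenomena.CardyFormulaZ2.Cruxes.MagicFormulaT.LineSketch

end
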